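import Summits.ResolutionOfSingularities.ResolutionOfSingularities.Theorems.WildReflectionLU
import Summits.ResolutionOfSingularities.ResolutionOfSingularities.Theorems.TameTwoStoreyLU2
import HarnessLib

/-!
# WildReflectionLU2 — PART B: THE CELL `WildPseudoReflectionLUAbove k O` and THE LAW `relLU_of_wildPseudoReflectionLUAbove` (hypothesis-free, every `d`, every `p`)

One of the three landing files of the g31 node «ReflectionCut» of the ROOT/RESIDUAL decomposition cell `decomp-res`
(lens 1; Door C (W-wild) of NEXT-g31, critic rows 187 / 213 / 229 and pre-ruling 229a; files `WildReflectionLU`,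
`…LU2`, `…LU3`); see the module docstring of `Summits.ResolutionOfSingularities.ResolutionOfSingularities.Theorems.WildReflectionLU` for the thesis
(Király–Lütkebohmert's theorem on `ℤ/p`-actions with principal augmentation ideal = pseudo-reflections,
[KiralyLutkebohmert2013, Thm. 2 (a) ⇒ (d)], REUSED BY NAME from the tree at a valuation centre), the cell
`WildPseudoReflectionLUAbove k O` and the law `relLU_of_wildPseudoReflectionLUAbove` (in `…LU2`), the costume diff,
the paper instance, the honest scope (a banked SUB-CELL of the wild axis) and the sources.  This file: the cell (`def : Prop`, same audit class as the landed tame / decomposition cells) and the law (Galois frame, `E^g = ι(K)` for a generator of the prime-order group, ONE call of the model clause, THE ENGINE of `…WildReflectionLU`, Artin–Tate, transport).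
Imports: the slice `…WildReflectionLU` (PART A) and the landed `…TameTwoStoreyLU2` (`relLU_transport`, `modelAbove`).  Problem side, sorry-free, hypothesis-free (zero fact binders); every heavy theorem carries
`set_option maxHeartbeats … in` BEFORE its docstring — keep it.
-/

noncomputable section

open Literature.AlgebraicGeometry.Resolution
open Summit.ResolutionOfSingularities.ResolutionOfSingularities.Theorems.InertDescentLU
open Summit.ResolutionOfSingularities.ResolutionOfSingularities.Theorems.InvariantDescentLU

universe u

namespace Summit.ResolutionOfSingularities.ResolutionOfSingularities.Theorems.WildReflectionLU

variable {E : Type u} [Field E]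

/-! ## PART B. THE WILD PSEUDO-REFLECTION CELL and its hypothesis-free LAW -/

section Law

open IsLocalRing Polynomial IntermediateField
open Summit.ResolutionOfSingularities.ResolutionOfSingularities.Theorems.TameQuotientLU
open Summit.ResolutionOfSingularities.ResolutionOfSingularities.Theorems.TameAbelianQuotientLU
open Summit.ResolutionOfSingularities.ResolutionOfSingularities.Theorems.TameTwoStoreyLU

variable (k : Type) [Field k] {K : Type} [Field K] [Algebra k K]

/-- **THE WILD PSEUDO-REFLECTION CELL** (`ℤ/p`-quotient step with PRINCIPAL AUGMENTATION IDEAL upstairs).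
`K′/K` Galois of prime degree equal to the characteristic (`([K′:K] : k) = 0`), `O′` a `G`-stable prolongation of
`O`, and above every f.g. birational `R ⊆ O` a `G`-stable f.g. model `ι(R)[t₀] ⊆ O′`, regular at the centre of `O′`,
carrying a PSEUDO-REFLECTION: `g ∈ G` and `y` in the model with `g y ≠ y` and `g b − b ∈ (g y − y)·(model)_𝔪′` for
every `b` in the model (KL Thm. 2 condition (a) with a named generator; = a pseudo-reflection in the sense of
Lorenzini–Schröer Rem. 6.20). [cite: KiralyLutkebohmert2013, Def. 1, Thm. 2 (a), p. 64] [cite: LorenziniSchroer2019, Rem. 6.20] -/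
def WildPseudoReflectionLUAbove (O : ValuationSubring K) : Prop :=
  ∃ K' : IntermediateField K (AlgebraicClosure K), FiniteDimensional K K' ∧ IsGalois K K' ∧
    (Module.finrank K K').Prime ∧ ((Module.finrank K K' : ℕ) : k) = 0 ∧
    ∃ O' : ValuationSubring K', O'.comap (algebraMap K K') = O ∧
      (∀ g : K' ≃ₐ[K] K', ∀ y : K', y ∈ O' ↔ g y ∈ O') ∧
      ∀ R : Subalgebra k K, R.FG → IsFractionRing R K → R.toSubring ≤ O.toSubring →
        ∃ t₀ : Finset K', modelAbove k R K' t₀ ≤ O'.toSubring ∧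
          (∀ g : K' ≃ₐ[K] K', ∀ y ∈ modelAbove k R K' t₀, g y ∈ modelAbove k R K' t₀) ∧
          IsRegularLocalRing (locAtCentre (modelAbove k R K' t₀) O') ∧
          ∃ g : K' ≃ₐ[K] K', ∃ y ∈ modelAbove k R K' t₀, g y ≠ y ∧
            ∀ b ∈ modelAbove k R K' t₀, ∃ c ∈ locAtCentre (modelAbove k R K' t₀) O',
              g b - b = (g y - y) * c

variable {k}

set_option maxHeartbeats 400000 in
/-- **THE LAW OF THE WILD PSEUDO-REFLECTION CELL** (hypothesis-free, every `d`, every `p`):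
`WildPseudoReflectionLUAbove k O → RelLocalUniformization k K O`.  Galois frame (`H = G` as ring automorphisms,
`E^H = ι(K)` by `IsGalois`); `g ≠ 1` generates the group of prime order, so `E^g = ι(K)`
(`mem_powers_of_prime_card`); ONE call of the model clause; THE ENGINE
(`isRegularLocalRing_locAtCentre_inf_fixed_of_isPrincipal` = [KiralyLutkebohmert2013, Thm. 2 (a) ⇒ (d)] by
name); Artin–Tate (`InvariantDescentLU2.exists_finset_inf_fixed_eq_closure`) writes the invariant model as
`ι(R)[t]` with `t ⊆ ι(K)`; `TameTwoStoreyLU2.relLU_transport` descends to `K`.  The clause `([K′:K] : k) = 0` of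
the cell is NOT used by the proof ([KiralyLutkebohmert2013] is characteristic-free): it only LOCATES the cell on the
wild axis. [cite: KiralyLutkebohmert2013, Thm. 2 (a) ⇒ (d), pp. 64–65] -/
theorem relLU_of_wildPseudoReflectionLUAbove {O : ValuationSubring K} (h : WildPseudoReflectionLUAbove k O) :
    RelLocalUniformization k K O := by
  classical
  obtain ⟨K', hfd, hgal, hprime, -, O', hO'O, hGO', hmodel⟩ := h
  haveI := hfd
  haveI := hgal
  intro R hRfg hRfrac hRO
  haveI := hRfrac
  obtain ⟨t₀, hMO, hGM, hMreg, g, y, hyM, hgy, hPRg⟩ := hmodel R hRfg hRfrac hRO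
  -- the prime `p = [K′ : K]`
  set p : ℕ := Module.finrank K K' with hpdef
  haveI hpF : Fact p.Prime := ⟨hprime⟩
  let ι : K →+* K' := (algebraMap K K' : K →+* K')
  have hgf : ∀ (g : K' ≃ₐ[K] K') (x : K), g (ι x) = ι x := fun g x => g.commutes x
  -- the finite frame `Gfin ⊆ K′ ≃+* K′`, fixed field `ι(K)`
  let Gfin : Finset (K' ≃+* K') := Finset.univ.image fun g : K' ≃ₐ[K] K' => (g : K' ≃+* K')
  have hGfin : ∀ g' ∈ Gfin, ∃ g : K' ≃ₐ[K] K', (g : K' ≃+* K') = g' := fun g' hg' => by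
    obtain ⟨g, -, hg⟩ := Finset.mem_image.mp hg'
    exact ⟨g, hg⟩
  have hmemGfin : ∀ g : K' ≃ₐ[K] K', (g : K' ≃+* K') ∈ Gfin := fun g =>
    Finset.mem_image.mpr ⟨g, Finset.mem_univ _, rfl⟩
  have hcoe1 : ((1 : K' ≃ₐ[K] K') : K' ≃+* K') = 1 := RingEquiv.ext fun _ => rfl
  have hcoemul : ∀ g g' : K' ≃ₐ[K] K', ((g * g' : K' ≃ₐ[K] K') : K' ≃+* K') =
      (g : K' ≃+* K') * (g' : K' ≃+* K') := fun _ _ => RingEquiv.ext fun _ => rfl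
  have hcoepow : ∀ (g : K' ≃ₐ[K] K') (n : ℕ), ((g ^ n : K' ≃ₐ[K] K') : K' ≃+* K') = (g : K' ≃+* K') ^ n := by
    intro g n
    induction n with
    | zero => rw [pow_zero, pow_zero, hcoe1]
    | succ n ih => rw [pow_succ, pow_succ, hcoemul, ih]
  have h1G : (1 : K' ≃+* K') ∈ Gfin := hcoe1 ▸ hmemGfin 1
  have hmulG : ∀ a ∈ Gfin, ∀ b ∈ Gfin, a * b ∈ Gfin := by
    intro a ha b hb
    obtain ⟨g, rfl⟩ := hGfin a ha
    obtain ⟨g', rfl⟩ := hGfin b hb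
    rw [← hcoemul]
    exact hmemGfin _
  let Kfix : Subfield K' := ι.fieldRange
  have hKfix : ∀ z : K', z ∈ Kfix ↔ ∀ h ∈ Gfin, h z = z := by
    intro z
    constructor
    · intro hz h hh
      obtain ⟨x, rfl⟩ := RingHom.mem_fieldRange.mp hz
      obtain ⟨g, rfl⟩ := hGfin h hh
      exact hgf g x
    · intro hz
      obtain ⟨x, hx⟩ := exists_algebraMap_eq_of_fixed_all (K := K) fun g => hz _ (hmemGfin g)
      exact RingHom.mem_fieldRange.mpr ⟨x, hx⟩
  have hHO : ∀ h ∈ Gfin, ∀ z : K', z ∈ O' ↔ h z ∈ O' := by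
    intro h hh z
    obtain ⟨g, rfl⟩ := hGfin h hh
    exact hGO' g z
  -- the model `M = ι(R)[t₀]`
  set S' : Subring K' := R.toSubring.map ι with hS'def
  set M : Subring K' := modelAbove k R K' t₀ with hMdef
  have hMgen : M = Subring.closure ((S' : Set K') ∪ (t₀ : Set K')) := rfl
  have hS'M : S' ≤ M := fun w hw => Subring.subset_closure (Or.inl hw)
  have hRS : ∀ x ∈ R, ι x ∈ S' := fun x hx => Subring.mem_map.mpr ⟨x, hx, rfl⟩
  have hS'K : S' ≤ Kfix.toSubring := by
    rintro w hw
    obtain ⟨x, -, rfl⟩ := Subring.mem_map.mp hw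
    exact RingHom.mem_fieldRange.mpr ⟨x, rfl⟩
  have hMH : ∀ h ∈ Gfin, ∀ z ∈ M, h z ∈ M := by
    intro h hh z hz
    obtain ⟨g, rfl⟩ := hGfin h hh
    exact hGM g z hz
  haveI : Algebra.FiniteType k R := (Subalgebra.fg_iff_finiteType R).mp hRfg
  haveI : IsNoetherianRing R := Algebra.FiniteType.isNoetherianRing k R
  haveI hS'noeth : IsNoetherianRing S' :=
    isNoetherianRing_of_surjective R S' (ι.restrict R S' hRS) (by
      rintro ⟨w, hw⟩
      obtain ⟨x, hx, rfl⟩ := Subring.mem_map.mp hw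
      exact ⟨⟨x, hx⟩, rfl⟩)
  -- the datum `σ = g`: `σ^p = 1`, and `g ≠ 1` generates `G` (prime order), so `E^σ = ι(K)`
  set σ : K' ≃+* K' := (g : K' ≃+* K') with hσdef
  have hσG : σ ∈ Gfin := hmemGfin g
  have hcard : Nat.card (K' ≃ₐ[K] K') = p := IsGalois.card_aut_eq_finrank K K'
  have hσp : σ ^ p = 1 := by
    have hgp : g ^ p = 1 := by rw [← hcard]; exact pow_card_eq_one'
    rw [hσdef, ← hcoepow, hgp, hcoe1]
  have hσy : σ y ≠ y := hgy
  have hg1 : g ≠ 1 := by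
    rintro rfl
    exact hgy (AlgEquiv.one_apply y)
  have hfixall : ∀ z : K', g z = z → ∀ g' : K' ≃ₐ[K] K', g' z = z := by
    intro z hz g'
    obtain ⟨m, rfl⟩ := (Submonoid.mem_powers_iff _ _).mp (mem_powers_of_prime_card hcard hg1 (g' := g'))
    induction m with
    | zero => rw [pow_zero, AlgEquiv.one_apply]
    | succ m ih => rw [pow_succ, AlgEquiv.mul_apply, hz]; exact ih
  have hσK : ∀ z : K', σ z = z → z ∈ Kfix := fun z hz =>
    (hKfix z).mpr fun h hh => by
      obtain ⟨g', rfl⟩ := hGfin h hh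
      exact hfixall z hz g'
  have hPR : ∀ b ∈ M, ∃ c ∈ locAtCentre M O', σ b - b = (σ y - y) * c := hPRg
  -- THE ENGINE ([KiralyLutkebohmert2013, Thm. 2 (a) ⇒ (d)] by name)
  have hT₂reg : IsRegularLocalRing (locAtCentre (M ⊓ Kfix.toSubring) O') :=
    isRegularLocalRing_locAtCentre_inf_fixed_of_isPrincipal O' Gfin Kfix M p hprime h1G hmulG hKfix hHO
      hMO hMH hMreg hσG hσp hσK hyM hσy hPR
  -- Artin–Tate: `M ∩ ι(K) = ι(R)[t]`, `t ⊆ ι(K)`; transport down to `K`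
  obtain ⟨t, htsub, hteq⟩ := exists_finset_inf_fixed_eq_closure Gfin Kfix M h1G hmulG hKfix hMH S' hS'K t₀ hMgen
  have ht_sub : (t : Set K') ⊆ Set.range ι := by
    intro w hw
    have h1 : w ∈ Kfix := (Subring.mem_inf.mp (htsub hw)).2
    exact RingHom.mem_fieldRange.mp h1
  have hTO : Subring.closure ((S' : Set K') ∪ (t : Set K')) ≤ O'.toSubring := by
    rw [← hteq]
    exact inf_le_left.trans hMO
  have hTreg : IsRegularLocalRing (locAtCentre (Subring.closure ((S' : Set K') ∪ (t : Set K'))) O') := by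
    rw [← hteq]
    exact hT₂reg
  exact relLU_transport hO'O hRfg t ht_sub hTO hTreg

end Law

end Summit.ResolutionOfSingularities.ResolutionOfSingularities.Theorems.WildReflectionLU

end
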